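import Literature.MathematicalPhysics.QuantumFieldTheory.Balaban1983to89.B9Thm312WholeH
import Literature.MathematicalPhysics.QuantumFieldTheory.Balaban1983to89.B9Thm312WholeLeafLeftGlob

/-!
# `Balaban1983to89.B9Thm312WholeLeafH` — [B9] Theorem 3.12 (p. 423) AS THE WHOLE PRINTED LEAF `B9.Thm312Printed` AT THE PINS, with
# (3.42)₁,₂,₃, (3.47)₀,₁,₂ for G, G₁ AND the two sup members of (3.133) for H, H₁ PROVED INSIDE (the family theorem over
# `…B9Thm312WholeH`)

T. Bałaban, *Propagators for lattice gauge theories in a background field*, Commun. Math. Phys. **99** (1985) 389–434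
[`Balaban1985BackgroundPropagators`, "B9"]; [4] = T. Bałaban, *Propagators and renormalization transformations for lattice
gauge theories. II*, Commun. Math. Phys. **96** (1984) 223–250 [`Balaban1984PropagatorsII`].

statement-level skeleton of published theorems with citation tags; proofs where landed; nothing here is a claim about the
Yang–Mills mass gap

THE PRINTED LOCI are those of `…B9Thm312Whole`, `…B9Thm312WholeLeft`, `…B9Thm312WholeH` (pp. 397–398, 420–423: (3.41), (3.42), (3.47), (3.126),
(3.129), (3.130), (3.132), (3.133), (3.138), Theorem 3.12 verbatim there); p. 422: *"The above inequality [(3.132)] together with Theorem 3.3 for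
G, with the exception of the inequality involving the covariant Laplace operator in (3.42), give [(3.133)]"*; p. 423: *"From (3.129) and (3.132)
with G₁ instead of G we get the inequalities (3.133) for H₁"*.

WHAT THIS FILE PROVES (one theorem — 0 `def`, 0 named fact, 0 sorry): ★ `thm312Printed_of_stepDH` — `B9.Thm312Printed d c35 geo bg GD G₁ Hk H₁k (fun i =>
HasRWExpOfOps (𝔬 i)) (fun i => HasRWExpHOfOps (𝔬 i)) (fun i => PosDefKOfOps (𝔬 i))`, the conclusion and pins of seat n06-l's row-20 leaves, from the inputs
of `…B9Thm312WholeLeafLeftGlob.thm312Printed_of_stepD` VERBATIM (g0's `hgeo`, `S`, `hrow`, `hco`, `hmodel`; g2's `hL1`, `hLle`, `hη`, `hL21`, `hco1`, `hread`,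
`hnull`, `hleft`) PLUS: `hlettersH` (`B9Thm312WholeH.LettersH`: G₀Q*, ∇_UG₀Q* on the coarse classes and (3.132) for (QGQ*)⁻¹, (QG₁Q*)⁻¹ — the knit's leaf
`s3132` between block norms), `hcoH` (the H-kernel co-readings `CoRealizesH` of `Hk`, `H₁k` by H(U), ∇_U∘H(U), H₁(U), ∇_U∘H₁(U)), `σ ≧ 0`, `ρ + σ ≦ δ₃`,
`α ≦ ½`.  PROVED INSIDE: everything `thm312Printed_of_stepD` proves AND the two sup members |H(x,y′)|, |∇_UH(x,y′)| of (3.133) for H and H₁ (`H_entry0`,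
`H_entry1` via (3.126)∕(3.129), the scale transfer of [4] (2.60) at (ρ, α), the co-reading; rate (1−α)ρ ≧ ρ∕2).  RESIDUAL DISPLAYED (`hres`): the L²
block (3.46) and the Hölder block (3.43)–(3.45) for `GD`, `G₁`, and the HÖLDER member ‖ζ∇H(·,y′)‖_β of (3.133) for `Hk`, `H₁k` — NOT proved here.
Quantifiers: M₄ := max(M₁, M_L, M_L′), a₀ := min(a₁, (2(θ₁c + 1))⁻¹, (2(r₁ + 1))⁻¹), δ₀ := min(ρ, δ₁), one constant above all proved and displayed ones.

HONEST SCOPE.  Nothing of print is asserted: every analytic input is a HYPOTHESIS of printed ∕ definitional shape; the residual members listed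
are NOT proved here.  Value: kernel-checked bookkeeping — NOT a node discharge, NOT summit progress; one finite lattice at a time; nothing
continuum, nothing about the mass gap.  Cell `pub-ymgap` (HUMAN RULING D-0062), Track A node N06 [B9], N06-ASSIGNMENT v1 row 20 (bundle F7), seat
`pub-ymgap-dag-n06-l` (g2), 2026-08-27.
-/

namespace Literature.MathematicalPhysics.QuantumFieldTheory.Balaban1983to89.B9Thm312WholeLeafH

open Literature.MathematicalPhysics.QuantumFieldTheory.Balaban1983to89
open Finset B6RandomWalk B6RandomWalkHom B9Thm34Ext B9Thm37GlueCor36 B11SectG B9SectDSup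
open B9Thm37AllNorms B9Thm37AllNormsInstances B9FromB6 B9FromB6ModelSignsOn B9SectBStepWhole B9Thm312Whole B9Thm312WholeLeaf
open B9Thm312WholeLeft B9Thm312WholeH B9Thm312WholeLeafLeftGlob

noncomputable section

section Family

variable {I : Type} {d : ℕ} {c35 : ℝ} {geo : I → B9.Geometry} {bg : I → B9.Backgrounds}
variable [∀ i, Fintype (geo i).Site]
variable {X Y Z W : I → Type} [∀ i, Fintype (X i)] [∀ i, DecidableEq (X i)] [∀ i, Fintype (Y i)]
  [∀ i, Fintype (Z i)] [∀ i, Fintype (W i)]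

omit [∀ i, Fintype (X i)] [∀ i, DecidableEq (X i)] [∀ i, Fintype (Y i)] [∀ i, Fintype (Z i)] [∀ i, Fintype (W i)]
  [∀ i, Fintype (geo i).Site] in
/-- Arithmetic of *"for α₀ sufficiently small"*: t ≧ 0 and m ≦ (2(t + 1))⁻¹ give tm ≦ ½. [folklore] -/
private theorem small_aux₃ {t m : ℝ} (ht : 0 ≤ t) (hm : m ≤ (2 * (t + 1))⁻¹) : t * m ≤ 1 / 2 := by
  have hpos : 0 < 2 * (t + 1) := by linarith
  have h1 : t * m ≤ t * (2 * (t + 1))⁻¹ := mul_le_mul_of_nonneg_left hm ht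
  have h2 : t * (2 * (t + 1))⁻¹ ≤ 1 / 2 := by
    rw [← div_eq_mul_inv, div_le_iff₀ hpos]
    linarith
  linarith

/-- ★ **THEOREM 3.12 AS THE WHOLE PRINTED LEAF `B9.Thm312Printed`, AT THE PINS, WITH (3.42)₁,₂,₃, (3.47)₀,₁,₂ FOR G, G₁ AND THE SUP MEMBERS OF (3.133) FOR
H, H₁ PROVED INSIDE** (p. 423: *"… Theorems 3.3, 3.10, 3.11 hold for the propagators G, G₁, with one exception and the inequality (3.133) together with
Theorem 3.10 hold for the operators H, H₁"*).  Inputs: those of `thm312Printed_of_stepD` verbatim, plus `hlettersH` (`LettersH (𝔬 i) (R₀ i) (H₀ i) (hgeo i) B₃ δ₃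
U` under the provisos), `hcoH` (the four H-kernel co-readings), `hσ : 0 ≦ σ`, `hρ₃ : ρ + σ ≦ δ₃`, `hα : α ≦ ½`.  PROVED INSIDE: (3.42)₁,₂,₃ and (3.47)₀,₁,₂ for
G, G₁ (as before) and, for Hk′ ∈ [Hk, H₁k], the sup conjunct of `B9.Ineq3133`: H = G∘(Q*C) (`Identities.eq126`) as a right entry (`H_entry0`), ∇_UH as a
left-and-right entry (`H_entry1`), the class ratio (L^jη∕L^{j′}η)² transferred by [4] (2.60) at (ρ, α) from `hL21` (factor L² ≦ L_c², rate loss αρ —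
whence `α ≦ ½` so that (1−α)ρ ≧ δ₀∕2), read through `CoRealizesH` (`hk_e0_of_hasMaj`, `hk_e1_of_hasMaj`, `ineq3133_sup_of_entries`); the same for H₁ with
(3.129), G₁, (QG₁Q*)⁻¹.  RESIDUAL DISPLAYED (`hres`): (3.46) and (3.43)–(3.45) for `GD`, `G₁`; the Hölder member of (3.133) for `Hk`, `H₁k` (verbatim
second conjunct of `B9.Ineq3133` at (B(β), δ₁)).  Quantifiers: M₄ := max(M₁, M_L, M_L′), a₀ := min(a₁, (2(θ₁c + 1))⁻¹, (2(r₁ + 1))⁻¹), δ₀ := min(ρ, δ₁),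
B₀ := max over the proved and displayed constants and 1.  Nothing of print asserted; NOT a node discharge.
[cite: Balaban1985BackgroundPropagators, Thm 3.12 pp.421–423 + (3.42) p.397 + (3.47) p.398 + (3.126) p.420 + (3.129) p.421 + (3.132)–(3.133) p.422; Balaban1984PropagatorsII, Lemma 2.1 (2.60)–(2.61) p.234] -/
theorem thm312Printed_of_stepDH (𝔬 : ∀ i, Ops (geo i) (bg i) (X i) (Y i) (Z i) (W i)) (R₀ : I → ℝ) (H₀ : I → Prop)
    (GD G₁ : ∀ i, B9.KernelFamily (geo i) (bg i)) (Hk H₁k : ∀ i, B9.HKernel (geo i) (bg i))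
    (ev : ∀ i, (geo i).Loc → X i → ℝ) (evY : ∀ i, (geo i).Loc → Y i → ℝ) {P : ∀ i, (geo i).Loc → Prop}
    (PG : ∀ i, (geo i).Loc → Prop) (res : ∀ i, (geo i).Site → (geo i).Loc → (geo i).Loc)
    (θ₁ θD r₁ B₀ δ₀ δK σ c ρ a₁ M₁ ML B₁ δ₁ B₃ δ₃ α Lc : ℝ) (Bβ Bε : ℝ → ℝ) (Bεβ : ℝ → ℝ → ℝ)
    (hθ₁ : 0 ≤ θ₁) (hθD : 0 ≤ θD) (hr₁ : 0 ≤ r₁) (hB₀ : 0 ≤ B₀) (hB₃ : 0 ≤ B₃) (hσ : 0 ≤ σ) (hρ : 0 < ρ) (hρS : ρ ≤ δ₀)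
    (hρδ : ρ + σ ≤ δK) (hρ₃ : ρ + σ ≤ δ₃) (hc : 0 ≤ c) (ha₁ : 0 < a₁) (hM₁ : 0 < M₁) (hδ₁ : 0 < δ₁) (hα : α ≤ 1 / 2)
    (hBβ : ∀ β, 0 ≤ Bβ β) (hBε : ∀ ε, 0 ≤ Bε ε) (hBεβ : ∀ ε β, 0 ≤ Bεβ ε β)
    (hgeo : ∀ i, GeoOK (geo i)) (S : ∀ i, ModelSignsOn (geo i) (P i))
    (hL1 : ∀ i, 1 ≤ (geo i).L) (hLle : ∀ i, (geo i).L ≤ Lc) (hη : ∀ i, 0 < (geo i).eta)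
    (hrow : ∀ i, ML ≤ (geo i).M → RowSum (toB6 (geo i) (R₀ i) (H₀ i)) σ c)
    (hL21 : ∀ δ : ℝ, 0 < δ → ∃ ML' c' : ℝ, Lemma21AboveG geo R₀ H₀ δ α ML' c')
    (hco : ∀ (i : I) (U : (bg i).Cfg),
      CoRealizes (GD i) 0 U (𝔬 i).blk (𝔬 i).blk (ev i) ((𝔬 i).G U) ∧
      CoRealizes (GD i) 2 U (𝔬 i).blk (𝔬 i).blkY (evY i) ((𝔬 i).G U ∘ₗ (𝔬 i).Dstar U) ∧
      CoRealizes (G₁ i) 0 U (𝔬 i).blk (𝔬 i).blk (ev i) ((𝔬 i).G1 U) ∧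
      CoRealizes (G₁ i) 2 U (𝔬 i).blk (𝔬 i).blkY (evY i) ((𝔬 i).G1 U ∘ₗ (𝔬 i).Dstar U))
    (hco1 : ∀ (i : I) (U : (bg i).Cfg),
      CoRealizes (GD i) 1 U (𝔬 i).blkY (𝔬 i).blk (ev i) ((𝔬 i).D U ∘ₗ (𝔬 i).G U) ∧
      CoRealizes (G₁ i) 1 U (𝔬 i).blkY (𝔬 i).blk (ev i) ((𝔬 i).D U ∘ₗ (𝔬 i).G1 U))
    (hcoH : ∀ (i : I) (U : (bg i).Cfg),
      CoRealizesH (Hk i) 0 U d (𝔬 i).blk (𝔬 i).blkZ ((𝔬 i).Hm U) ∧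
      CoRealizesH (Hk i) 1 U d (𝔬 i).blkY (𝔬 i).blkZ ((𝔬 i).D U ∘ₗ (𝔬 i).Hm U) ∧
      CoRealizesH (H₁k i) 0 U d (𝔬 i).blk (𝔬 i).blkZ ((𝔬 i).H1m U) ∧
      CoRealizesH (H₁k i) 1 U d (𝔬 i).blkY (𝔬 i).blkZ ((𝔬 i).D U ∘ₗ (𝔬 i).H1m U))
    (hread : ∀ (i : I) (U : (bg i).Cfg),
      B9Ineq347Reading.GlobReading (GD i) (PG i) U (res i) ∧ B9Ineq347Reading.GlobReading (G₁ i) (PG i) U (res i))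
    (hnull : ∀ (i : I) (U : (bg i).Cfg) (n : Fin 4) (lam : (geo i).Loc) (γ : ℝ), ¬ PG i lam →
      (GD i).glob n U lam γ ≤ 0 ∧ (G₁ i).glob n U lam γ ≤ 0)
    (hmodel : ∀ i, M₁ ≤ (geo i).M → ∀ α₀ : ℝ, 0 < α₀ → (geo i).M * α₀ ≤ a₁ →
      ∀ U : (bg i).Cfg, (bg i).Reg335 c35 α₀ U → (bg i).Reg336 c35 α₀ U →
        Thm33G0 (𝔬 i) (R₀ i) (H₀ i) B₀ δ₀ U ∧
        Step (𝔬 i) (R₀ i) (H₀ i) (hgeo i).lenle 1 (θ₁ * ((geo i).M * α₀)) δK U ∧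
        Step (𝔬 i) (R₀ i) (H₀ i) (hgeo i).lenle 2 (θ₁ * ((geo i).M * α₀)) δK U ∧
        FormSmall (𝔬 i) (r₁ * ((geo i).M * α₀)) U ∧ Identities (𝔬 i) U)
    (hleft : ∀ i, M₁ ≤ (geo i).M → ∀ α₀ : ℝ, 0 < α₀ → (geo i).M * α₀ ≤ a₁ →
      ∀ U : (bg i).Cfg, (bg i).Reg335 c35 α₀ U → (bg i).Reg336 c35 α₀ U →
        LeftStep (𝔬 i) (R₀ i) (H₀ i) (hgeo i).lenle B₀ δ₀ (θD * ((geo i).M * α₀)) δK U)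
    (hlettersH : ∀ i, M₁ ≤ (geo i).M → ∀ α₀ : ℝ, 0 < α₀ → (geo i).M * α₀ ≤ a₁ →
      ∀ U : (bg i).Cfg, (bg i).Reg335 c35 α₀ U → (bg i).Reg336 c35 α₀ U →
        LettersH (𝔬 i) (R₀ i) (H₀ i) (hgeo i) B₃ δ₃ U)
    (hres : ∀ i, M₁ ≤ (geo i).M → ∀ α₀ : ℝ, 0 < α₀ → (geo i).M * α₀ ≤ a₁ →
      ∀ U : (bg i).Cfg, (bg i).Reg335 c35 α₀ U → (bg i).Reg336 c35 α₀ U →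
        (∀ K ∈ [GD i, G₁ i], L2Block K B₁ δ₁ U ∧ B9.Ineq343_345 K Bβ Bε Bεβ δ₁ U) ∧
        (∀ Hk' ∈ [Hk i, H₁k i], ∀ (β : ℝ) (ζ : (geo i).Cut) (y y' : (geo i).Site), 0 ≤ β → β < 1 → (geo i).cutInT ζ y →
          Hk'.h U β ζ y' ≤ Bβ β * (geo i).cutH β ζ * ((geo i).len y) ^ (-(1 + β)) * ((geo i).len y') ^ (-(d : ℝ)) *
            Real.exp (-(δ₁ / 2 * (geo i).dist y y')))) :
    B9.Thm312Printed d c35 geo bg GD G₁ Hk H₁k (fun i => HasRWExpOfOps (𝔬 i)) (fun i => HasRWExpHOfOps (𝔬 i))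
      (fun i => PosDefKOfOps (𝔬 i)) := by
  -- the constants of the leaf
  obtain ⟨MLg, cg, hLg⟩ := hL21 ρ hρ
  set cg' : ℝ := max cg 0 with hcg'
  have hcg'0 : 0 ≤ cg' := le_max_right _ _
  set a₀ : ℝ := min a₁ (min (2 * (θ₁ * c + 1))⁻¹ (2 * (r₁ + 1))⁻¹) with ha₀
  set BL : ℝ := B₀ + θD * a₁ * (2 * B₀) * c with hBL
  set Bsup : ℝ := max (2 * B₀) BL with hBsup
  set Bgl : ℝ := Bsup * cg' * Lc ^ (4 : ℝ) with hBgl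
  set BH : ℝ := max (2 * (B₃ * B₃ * c)) (B₃ * B₃ * c + θD * a₁ * (2 * (B₃ * B₃ * c)) * c) with hBH
  set CH : ℝ := BH * Lc ^ (2 : ℝ) with hCH
  set Bout : ℝ := max (max (max (max Bsup Bgl) CH) B₁) 1 with hBout
  set δout : ℝ := min ρ δ₁ with hδout
  have hθc : 0 ≤ θ₁ * c := mul_nonneg hθ₁ hc
  have ha₀pos : 0 < a₀ := lt_min ha₁ (lt_min (inv_pos.mpr (by linarith)) (inv_pos.mpr (by linarith)))
  have hBsup2 : 2 * B₀ ≤ Bsup := le_max_left _ _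
  have hBsupL : BL ≤ Bsup := le_max_right _ _
  have hBsup0 : 0 ≤ Bsup := le_trans (by linarith) hBsup2
  have hB33 : 0 ≤ B₃ * B₃ * c := mul_nonneg (mul_nonneg hB₃ hB₃) hc
  have hBH2 : 2 * (B₃ * B₃ * c) ≤ BH := le_max_left _ _
  have hBHL : B₃ * B₃ * c + θD * a₁ * (2 * (B₃ * B₃ * c)) * c ≤ BH := le_max_right _ _
  have hBH0 : 0 ≤ BH := le_trans (by linarith) hBH2
  have hBoutS : Bsup ≤ Bout := (((le_max_left _ _).trans (le_max_left _ _)).trans (le_max_left _ _)).trans (le_max_left _ _)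
  have hBoutG : Bgl ≤ Bout := (((le_max_right _ _).trans (le_max_left _ _)).trans (le_max_left _ _)).trans (le_max_left _ _)
  have hBoutH : CH ≤ Bout := ((le_max_right _ _).trans (le_max_left _ _)).trans (le_max_left _ _)
  have hBoutB₁ : B₁ ≤ Bout := (le_max_right _ _).trans (le_max_left _ _)
  have hBout0 : 0 ≤ Bout := zero_le_one.trans (le_max_right _ _)
  have hδρ : δout ≤ ρ := min_le_left _ _
  have hδδ₁ : δout ≤ δ₁ := min_le_right _ _
  have hτ : δout ≤ 2 * ((1 - α) * ρ) := by
    have h1 : 0 ≤ (1 - 2 * α) * ρ := mul_nonneg (by linarith) hρ.le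
    have h2 : 2 * ((1 - α) * ρ) = ρ + (1 - 2 * α) * ρ := by ring
    rw [h2]
    linarith
  refine ⟨max (max M₁ ML) MLg, δout, a₀, Bout, Bβ, Bε, Bεβ, lt_max_of_lt_left (lt_max_of_lt_left hM₁), lt_min hρ hδ₁,
    ha₀pos, zero_lt_one.trans_le (le_max_right _ _), ?_⟩
  intro i hM α₀ hα₀ hMa U hU hU'
  have hM₁i : M₁ ≤ (geo i).M := ((le_max_left _ _).trans (le_max_left _ _)).trans hM
  have hMLi : ML ≤ (geo i).M := ((le_max_right _ _).trans (le_max_left _ _)).trans hM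
  have hMLgi : MLg ≤ (geo i).M := (le_max_right _ _).trans hM
  have hMpos : 0 < (geo i).M := hM₁.trans_le hM₁i
  have hm0 : 0 ≤ (geo i).M * α₀ := (mul_pos hMpos hα₀).le
  have hma₁ : (geo i).M * α₀ ≤ a₁ := hMa.trans (min_le_left _ _)
  have hmθ : (geo i).M * α₀ ≤ (2 * (θ₁ * c + 1))⁻¹ := hMa.trans ((min_le_right _ _).trans (min_le_left _ _))
  have hmr : (geo i).M * α₀ ≤ (2 * (r₁ + 1))⁻¹ := hMa.trans ((min_le_right _ _).trans (min_le_right _ _))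
  obtain ⟨h33, hS1, hS2, hF, hI⟩ := hmodel i hM₁i α₀ hα₀ hma₁ U hU hU'
  have hLS := hleft i hM₁i α₀ hα₀ hma₁ U hU hU'
  have hLH := hlettersH i hM₁i α₀ hα₀ hma₁ U hU hU'
  obtain ⟨hresK, hresH⟩ := hres i hM₁i α₀ hα₀ hma₁ U hU hU'
  have hrowi := hrow i hMLi
  obtain ⟨h260, hrowg, hsize⟩ := hLg i hMLgi
  have hrowg' : RowSum (toB6 (geo i) (R₀ i) (H₀ i)) ((1 - α) * ρ) cg' := fun y => (hrowg y).trans (le_max_left _ _)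
  set θ : ℝ := θ₁ * ((geo i).M * α₀) with hθdef
  set θ' : ℝ := θD * ((geo i).M * α₀) with hθ'def
  have hθ : 0 ≤ θ := mul_nonneg hθ₁ hm0
  have hθ' : 0 ≤ θ' := mul_nonneg hθD hm0
  have hq : θ * c ≤ 1 / 2 := by
    have h := small_aux₃ (mul_nonneg hθ₁ hc) hmθ
    calc θ * c = θ₁ * c * ((geo i).M * α₀) := by rw [hθdef]; ring
      _ ≤ 1 / 2 := h
  have hq1 : θ * c < 1 := lt_one_of_le_half hq
  have hr : r₁ * ((geo i).M * α₀) < 1 := by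
    have h := small_aux₃ hr₁ hmr
    linarith
  have hσδ : σ ≤ δK := (le_add_of_nonneg_left hρ.le).trans hρδ
  have hinv0 : 0 ≤ (1 - θ * c)⁻¹ := inv_nonneg.mpr (sub_nonneg.mpr hq1.le)
  have hinv2 : (1 - θ * c)⁻¹ ≤ 2 := inv_one_sub_le_two hq
  have hC0 : 0 ≤ B₀ * (1 - θ * c)⁻¹ := mul_nonneg hB₀ hinv0
  have hCle : B₀ * (1 - θ * c)⁻¹ ≤ Bsup := (const_le_two_mul hB₀ hq).trans hBsup2
  have hθ'le : θ' ≤ θD * a₁ := mul_le_mul_of_nonneg_left hma₁ hθD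
  have hC1 : 0 ≤ B₀ + θ' * (B₀ * (1 - θ * c)⁻¹) * c := add_nonneg hB₀ (mul_nonneg (mul_nonneg hθ' hC0) hc)
  have hC1le : B₀ + θ' * (B₀ * (1 - θ * c)⁻¹) * c ≤ Bsup := by
    have h2 : θ' * (B₀ * (1 - θ * c)⁻¹) ≤ θD * a₁ * (2 * B₀) :=
      mul_le_mul hθ'le (const_le_two_mul hB₀ hq) hC0 (mul_nonneg hθD ha₁.le)
    have h3 : θ' * (B₀ * (1 - θ * c)⁻¹) * c ≤ θD * a₁ * (2 * B₀) * c := mul_le_mul_of_nonneg_right h2 hc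
    have h4 : B₀ + θ' * (B₀ * (1 - θ * c)⁻¹) * c ≤ BL := by rw [hBL]; linarith
    exact h4.trans hBsupL
  have hfix := fix_of_inverses hI.invG0' hI.invG
  have hfix1 := fix_of_inverses hI.invG0' hI.invG1
  obtain ⟨hcoG0, hcoG2, hcoG10, hcoG12⟩ := hco i U
  obtain ⟨hcoG1, hcoG11⟩ := hco1 i U
  obtain ⟨hcH0, hcH1, hcH10, hcH11⟩ := hcoH i U
  obtain ⟨hRD, hR1⟩ := hread i U
  have hlen := (hgeo i).lenle
  -- the proved clauses (3.42)₁,₂,₃ at the rate ρ with the one constant Bsup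
  have mono : ∀ {K : B9.KernelFamily (geo i) (bg i)} {n : Fin 4} {C : ℝ}, Clause342 K n C ρ U → 0 ≤ C → C ≤ Bsup →
      Clause342 K n Bsup ρ U := fun h h0 hle =>
    clause342_mono h h0 hle le_rfl (S i).dist_nonneg hlen (S i).supNorm_nonneg
  have clG0 : Clause342 (GD i) 0 Bsup ρ U := mono (clause342_e0_of_hasMajorant hcoG0
    (entry0_of_step (hgeo i) hrowi hθ hB₀ hρ.le hρS hρδ hS2.step h33.e0 hfix hq1) hC0 hlen) hC0 hCle
  have clG1 : Clause342 (GD i) 1 Bsup ρ U := mono (clause342_e1_of_hasMajorantHom hcoG1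
    (entry1_of_stepD (hgeo i) hrowi hθ hθ' hB₀ hρ.le hρS hρδ hS2.step hLS.stepD h33.e0 hLS.e1 hfix hq1) hC1 hlen) hC1 hC1le
  have clG2 : Clause342 (GD i) 2 Bsup ρ U := mono (clause342_e2_of_hasMajorantHom hcoG2
    (entry2_of_step (hgeo i) hrowi hθ hB₀ hρ.le hρS hρδ hS1.step h33.e2 hfix hq1) hC0 hlen) hC0 hCle
  have clG10 : Clause342 (G₁ i) 0 Bsup ρ U := mono (clause342_e0_of_hasMajorant hcoG10
    (entry0_of_step (hgeo i) hrowi hθ hB₀ hρ.le hρS hρδ hS2.step1 h33.e0 hfix1 hq1) hC0 hlen) hC0 hCle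
  have clG11 : Clause342 (G₁ i) 1 Bsup ρ U := mono (clause342_e1_of_hasMajorantHom hcoG11
    (entry1_of_stepD (hgeo i) hrowi hθ hθ' hB₀ hρ.le hρS hρδ hS2.step1 hLS.stepD1 h33.e0 hLS.e1 hfix1 hq1) hC1 hlen)
    hC1 hC1le
  have clG12 : Clause342 (G₁ i) 2 Bsup ρ U := mono (clause342_e2_of_hasMajorantHom hcoG12
    (entry2_of_step (hgeo i) hrowi hθ hB₀ hρ.le hρS hρδ hS1.step1 h33.e2 hfix1 hq1) hC0 hlen) hC0 hCle
  -- the global entries (3.47)₀,₁,₂: one scale transfer and one row sum per entry, constant Bsup·c′·L⁴ ≦ Bout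
  have hL0i : 0 < (geo i).L := lt_of_lt_of_le one_pos (hL1 i)
  have hL4 : (geo i).L ^ (4 : ℝ) ≤ Lc ^ (4 : ℝ) := Real.rpow_le_rpow hL0i.le (hLle i) (by norm_num)
  have hCgl0 : 0 ≤ Bsup * cg' * (geo i).L ^ (4 : ℝ) := mul_nonneg (mul_nonneg hBsup0 hcg'0) (Real.rpow_nonneg hL0i.le _)
  have hCglle : Bsup * cg' * (geo i).L ^ (4 : ℝ) ≤ Bout :=
    (mul_le_mul_of_nonneg_left hL4 (mul_nonneg hBsup0 hcg'0)).trans hBoutG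
  have globK : ∀ {K : B9.KernelFamily (geo i) (bg i)}, B9Ineq347Reading.GlobReading K (PG i) U (res i) →
      (∀ (n : Fin 4) (lam : (geo i).Loc) (γ : ℝ), ¬ PG i lam → K.glob n U lam γ ≤ 0) →
      Clause342 K 0 Bsup ρ U → Clause342 K 1 Bsup ρ U → Clause342 K 2 Bsup ρ U →
      ∀ (n : Fin 4) (lam : (geo i).Loc) (γ : ℝ), n ≠ 3 → -4 ≤ γ → γ ≤ 4 →
        K.glob n U lam γ ≤ Bout * (geo i).wNorm γ lam := fun {K} hR hnl c0 c1 c2 =>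
    glob_noLap_of_entries (S i) hCgl0 hCgl0 hCgl0 hCglle hCglle hCglle
      (globEntry_of_clause342 hR 0 hBsup0 hcg'0 (hL1 i) (hη i) (S i).wNorm_nonneg hsize h260 hrowg' c0)
      (globEntry_of_clause342 hR 1 hBsup0 hcg'0 (hL1 i) (hη i) (S i).wNorm_nonneg hsize h260 hrowg' c1)
      (globEntry_of_clause342 hR 2 hBsup0 hcg'0 (hL1 i) (hη i) (S i).wNorm_nonneg hsize h260 hrowg' c2) hnl
  -- the residual members of G, G₁, brought to (Bout, δout)
  have resK : ∀ K : B9.KernelFamily (geo i) (bg i), K ∈ [GD i, G₁ i] → Clause342 K 0 Bsup ρ U → Clause342 K 1 Bsup ρ U →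
      Clause342 K 2 Bsup ρ U → B9Ineq347Reading.GlobReading K (PG i) U (res i) →
      (∀ (n : Fin 4) (lam : (geo i).Loc) (γ : ℝ), ¬ PG i lam → K.glob n U lam γ ≤ 0) →
      B9.Ineq342_346_347_noLap K Bout δout U ∧ B9.Ineq343_345 K Bβ Bε Bεβ δout U ∧
        HasRWExpOfOps (𝔬 i) K U δout ∧ PosDefKOfOps (𝔬 i) K U := by
    intro K hK c0 c1 c2 hR hnl
    obtain ⟨hl2, hho⟩ := hresK K hK
    have w : ∀ {m : Fin 4}, Clause342 K m Bsup ρ U → Clause342 K m Bout δout U := fun cm =>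
      clause342_mono cm hBsup0 hBoutS hδρ (S i).dist_nonneg hlen (S i).supNorm_nonneg
    exact ⟨⟨eNoLap_of_clauses (w c0) (w c1) (w c2), l2Block_mono (S i) hl2 hBoutB₁ hBout0 hδδ₁, globK hR hnl c0 c1 c2⟩,
      ineq343_345_mono (S i) hho (fun _ => le_rfl) hBβ (fun _ => le_rfl) hBε (fun _ _ => le_rfl) hBεβ hδδ₁,
      hasRWExp_of_schemas (hgeo i) hrowi hθ hσδ hq1 hS2 hI K δout, posDefK_of_schemas hr hF hI K⟩
  -- (3.133): H = G∘(Q*C), ∇H, H₁, ∇H₁ as entries; the class ratio transferred by (2.60) at (ρ, α); the co-readings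
  have hlogL : 0 ≤ Real.log (geo i).L := Real.log_nonneg (hL1 i)
  have hsz : |(2 : ℝ)| * Real.log (geo i).L ≤ α * ρ * R₀ i * (geo i).M := by
    rw [abs_of_pos (by norm_num : (0 : ℝ) < 2)]; linarith [hlogL, hsize]
  have hST : B9Ineq347.ScaleTransfer (geo i) ρ α ((geo i).L ^ |(2 : ℝ)|) (fun y => (geo i).len y ^ (2 : ℝ)) :=
    B9Ineq347.scaleTransfer_of_260 (geo i) ρ α (Real.exp (-(α * ρ * R₀ i * (geo i).M))) ((geo i).L ^ |(2 : ℝ)|)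
      (fun y => (geo i).len y ^ (2 : ℝ)) (fun y y' => Nat.dist ((geo i).scale y) ((geo i).scale y')) (Real.exp_nonneg _)
      (Real.one_le_rpow (hL1 i) (abs_nonneg _)) (B9Ineq347AllEntries.rpow_abs_mul_exp_le_one (geo i).L 2 _ hL0i hsz)
      (B9Ineq347AllEntries.weight_nonneg (geo i) hL0i (hη i) 2)
      (B9Ineq347AllEntries.h260_nat_of_Ineq260 (geo i) (R₀ i) (H₀ i) ρ α h260)
      (fun y y' => B9Ineq347AllEntries.weight_ratio (geo i) (hL1 i) (hη i) 2 y y')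
  have hΛle : (geo i).L ^ |(2 : ℝ)| ≤ Lc ^ (2 : ℝ) := by
    rw [abs_of_pos (by norm_num : (0 : ℝ) < 2)]
    exact Real.rpow_le_rpow hL0i.le (hLle i) (by norm_num)
  have hLc2 : 0 ≤ Lc ^ (2 : ℝ) := Real.rpow_nonneg (hL0i.le.trans (hLle i)) _
  have hST' : B9Ineq347.ScaleTransfer (geo i) ρ α (Lc ^ (2 : ℝ)) (fun y => (geo i).len y ^ (2 : ℝ)) := fun y y' =>
    (hST y y').trans (mul_le_mul_of_nonneg_right hΛle (B9Ineq347AllEntries.weight_nonneg (geo i) hL0i (hη i) 2 y))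
  -- the entry constants and their uniform bounds
  have hKH0 : 0 ≤ B₃ * B₃ * c * (1 - θ * c)⁻¹ := mul_nonneg hB33 hinv0
  have hKH0le : B₃ * B₃ * c * (1 - θ * c)⁻¹ ≤ BH := by
    have h1 : B₃ * B₃ * c * (1 - θ * c)⁻¹ ≤ B₃ * B₃ * c * 2 := mul_le_mul_of_nonneg_left hinv2 hB33
    linarith
  have hKH1 : 0 ≤ B₃ * B₃ * c + θ' * (B₃ * B₃ * c * (1 - θ * c)⁻¹) * c := add_nonneg hB33 (mul_nonneg (mul_nonneg hθ' hKH0) hc)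
  have hKH1le : B₃ * B₃ * c + θ' * (B₃ * B₃ * c * (1 - θ * c)⁻¹) * c ≤ BH := by
    have h1 : B₃ * B₃ * c * (1 - θ * c)⁻¹ ≤ 2 * (B₃ * B₃ * c) := by
      have := mul_le_mul_of_nonneg_left hinv2 hB33; linarith
    have h2 : θ' * (B₃ * B₃ * c * (1 - θ * c)⁻¹) ≤ θD * a₁ * (2 * (B₃ * B₃ * c)) :=
      mul_le_mul hθ'le h1 hKH0 (mul_nonneg hθD ha₁.le)
    have h3 : θ' * (B₃ * B₃ * c * (1 - θ * c)⁻¹) * c ≤ θD * a₁ * (2 * (B₃ * B₃ * c)) * c := mul_le_mul_of_nonneg_right h2 hc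
    linarith
  have hCHle : ∀ {K : ℝ}, K ≤ BH → K * Lc ^ (2 : ℝ) ≤ Bout := fun hK =>
    (mul_le_mul_of_nonneg_right hK hLc2).trans hBoutH
  have resH : ∀ (Hk' : B9.HKernel (geo i) (bg i)) (Hop : (Z i → ℝ) →ₗ[ℝ] (X i → ℝ)), Hk' ∈ [Hk i, H₁k i] →
      CoRealizesH Hk' 0 U d (𝔬 i).blk (𝔬 i).blkZ Hop → CoRealizesH Hk' 1 U d (𝔬 i).blkY (𝔬 i).blkZ ((𝔬 i).D U ∘ₗ Hop) →
      HasMaj (cNorm (R₀ i) (H₀ i) (𝔬 i).blkZ (hgeo i).lenle 2) (cNorm (R₀ i) (H₀ i) (𝔬 i).blk (hgeo i).lenle 2) Hop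
        (fun a b => B₃ * B₃ * c * (1 - θ * c)⁻¹ * Real.exp (-(ρ * (geo i).dist a b))) →
      HasMaj (cNorm (R₀ i) (H₀ i) (𝔬 i).blkZ (hgeo i).lenle 2) (cNorm (R₀ i) (H₀ i) (𝔬 i).blkY (hgeo i).lenle 1) ((𝔬 i).D U ∘ₗ Hop)
        (fun a b => (B₃ * B₃ * c + θ' * (B₃ * B₃ * c * (1 - θ * c)⁻¹) * c) * Real.exp (-(ρ * (geo i).dist a b))) →
      B9.Ineq3133 d Hk' Bout Bβ δout U ∧ HasRWExpHOfOps (𝔬 i) Hk' U δout := by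
    intro Hk' Hop hK hc0 hc1 hH0 hH1
    have h0 := hk_e0_of_hasMaj (hgeo i) hKH0 hLc2 hc0 hST' hH0
    have h1 := hk_e1_of_hasMaj (hgeo i) hKH1 hLc2 hc1 hST' hH1
    have hsup := ineq3133_sup_of_entries (hgeo i).lenpos (hCHle hKH0le) (hCHle hKH1le) h0 h1
    exact ⟨ineq3133_of_parts (S i) d (hgeo i).lenpos le_rfl hBout0 hBβ hτ hδδ₁ hsup (hresH Hk' hK),
      hasRWExpH_of_schemas (hgeo i) hrowi hθ hσδ hq1 hS2 hI Hk' δout⟩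
  have hH0 : HasMaj (cNorm (R₀ i) (H₀ i) (𝔬 i).blkZ (hgeo i).lenle 2) (cNorm (R₀ i) (H₀ i) (𝔬 i).blk (hgeo i).lenle 2) ((𝔬 i).Hm U)
      (fun a b => B₃ * B₃ * c * (1 - θ * c)⁻¹ * Real.exp (-(ρ * (geo i).dist a b))) := by
    rw [hI.eq126]
    exact H_entry0 (hgeo i) hrowi hc hθ hB₃ hσ hρ.le hρ₃ hρδ hS2.step hLH.gQs2 hLH.c2 hfix hq1
  have hH1 : HasMaj (cNorm (R₀ i) (H₀ i) (𝔬 i).blkZ (hgeo i).lenle 2) (cNorm (R₀ i) (H₀ i) (𝔬 i).blkY (hgeo i).lenle 1)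
      ((𝔬 i).D U ∘ₗ (𝔬 i).Hm U)
      (fun a b => (B₃ * B₃ * c + θ' * (B₃ * B₃ * c * (1 - θ * c)⁻¹) * c) * Real.exp (-(ρ * (geo i).dist a b))) := by
    rw [hI.eq126]
    exact H_entry1 (hgeo i) hrowi hc hθ hθ' hB₃ hσ hρ.le hρ₃ hρδ hS2.step hLS.stepD hLH.gQs2 hLH.dgQs hLH.c2 hfix hq1
  have hH10 : HasMaj (cNorm (R₀ i) (H₀ i) (𝔬 i).blkZ (hgeo i).lenle 2) (cNorm (R₀ i) (H₀ i) (𝔬 i).blk (hgeo i).lenle 2) ((𝔬 i).H1m U)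
      (fun a b => B₃ * B₃ * c * (1 - θ * c)⁻¹ * Real.exp (-(ρ * (geo i).dist a b))) := by
    rw [hI.eq129]
    exact H_entry0 (hgeo i) hrowi hc hθ hB₃ hσ hρ.le hρ₃ hρδ hS2.step1 hLH.gQs2 hLH.c12 hfix1 hq1
  have hH11 : HasMaj (cNorm (R₀ i) (H₀ i) (𝔬 i).blkZ (hgeo i).lenle 2) (cNorm (R₀ i) (H₀ i) (𝔬 i).blkY (hgeo i).lenle 1)
      ((𝔬 i).D U ∘ₗ (𝔬 i).H1m U)
      (fun a b => (B₃ * B₃ * c + θ' * (B₃ * B₃ * c * (1 - θ * c)⁻¹) * c) * Real.exp (-(ρ * (geo i).dist a b))) := by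
    rw [hI.eq129]
    exact H_entry1 (hgeo i) hrowi hc hθ hθ' hB₃ hσ hρ.le hρ₃ hρδ hS2.step1 hLS.stepD1 hLH.gQs2 hLH.dgQs hLH.c12 hfix1 hq1
  refine ⟨fun K hK => ?_, fun Hk' hK' => ?_⟩
  · have hK2 : K = GD i ∨ K = G₁ i := by simpa using hK
    rcases hK2 with rfl | rfl
    · exact resK _ hK clG0 clG1 clG2 hRD (fun n lam γ hP => (hnull i U n lam γ hP).1)
    · exact resK _ hK clG10 clG11 clG12 hR1 (fun n lam γ hP => (hnull i U n lam γ hP).2)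
  · have hK2 : Hk' = Hk i ∨ Hk' = H₁k i := by simpa using hK'
    rcases hK2 with rfl | rfl
    · exact resH _ _ hK' hcH0 hcH1 hH0 hH1
    · exact resH _ _ hK' hcH10 hcH11 hH10 hH11

end Family

end

end Literature.MathematicalPhysics.QuantumFieldTheory.Balaban1983to89.B9Thm312WholeLeafH
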